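/-
Copyright (c) 2026 the pub-hodgecm-mathlib formalisation cell (harness21).  Prover seat hodgecm-mathlib-K2E3-p11 (g7), Track B «K2-LIT» ∕ h413
(`stmt-HodgeConjecture-24833`), line `K2_E3_EllipticInputs`, road (11-3-split-nsc), leaf (nsc-S-A′) `sig_K2E3GL3PrincipalBlockStandardSpan` (owner K2E3-p25),
line «IH-x×x×x» (lead K2E3-p03 (g6); dealer K2E3-plan (g4) D71∕D78), brick IH-3, FILE 1∕2: THE IWAHORI FACTORISATION OF `Iw ≤ GL_n(F)` AND THE IWAHORI DATUM OF THE
BOREL AT LEVEL `Iw`.  2026-09-04.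
-/
import Summits.HodgeConjecture.HodgeConjecture.Theorems.K2E3GL3IwahoriBruhat   -- ★ IH-1 (K2E3-p03 (g6)): lifting `B(𝓀) → B ∩ GL_n(𝒪)`, `Iw = red⁻¹ B(𝓀)`; brings ★ `IwahoriGL`, ★ `IwasawaDecompositionGL` (`zpowDiagGL`)
import Literature.NumberTheory.Automorphic.ParabolicGLBigCell                  -- ★ `exists_parabolic_mul_lower_of_mem_congruenceGL`, `exists_conj_lower_mem_congruenceGL`, `map_mem_*`; brings ★ `CongruenceKernelIwahori`, ★ LeviCartan
import Literature.NumberTheory.Automorphic.JacquetLemma                        -- ★ `ParabolicTriple.IwahoriDatum` (the structure filled in §2)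
import HarnessLib

/-!
# K2_E3 road (h413), leaf (nsc-S-A′), line «IH-x×x×x», brick IH-3 (file 1∕2): the Iwahori factorisation `Iw = (Iw ∩ U⁻)(Iw ∩ T)(Iw ∩ U)` of the Iwahori
# subgroup of `GL_n(F)` and the Iwahori datum of the Borel at level `Iw`

Cell `pub/hodgecm-mathlib` (D-0151), Track B, seat K2E3-p11 (g7); line lead K2E3-p03 (g6), architect K2E3-p25 (`MEMO-H4-residues.v1` §2, route (H) «Iwahori–Hecke 6×6»).
`--supports stmt-HodgeConjecture-24833 --as helper`; THEOREMS ONLY (no definition ∕ instance ∕ notation ∕ named fact ∕ `sorry`); never imports `Cruxes/…/Lines`.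
COUNT-NEUTRAL helper, GENERIC in `n`.  Sequel (file 2∕2): `K2E3GL3IwahoriFixedOfJacquet` (Jacquet's first lemma at level `Iw` and the detection corollary).
SELF-CONTAINED over BUILT modules: the ★ sources `IwahoriDatumGL` (the datum at the levels `K_{|ϖ|^{j+1}}`) and `IwahoriFactorizationGL` (`K₁ = (K₁ ∩ B⁻)(K₁ ∩ B)`) had no
olean on the farm when this was typed (`lean check` rc 75 `unbuilt:…`, 2026-09-04T10:2xZ); their three folklore inputs are re-proved here in the generality used
(`blockDiagonalGL_leviProjection_mem_congruenceGL'` for any block labelling, `coe_congruenceGL_eq_mul` for the BOREL triple, the contraction in the inverse-power shape).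

NOTATION (spelled out inline).  `F` a field with a `ValuativeRel` (§1) ∕ a non-archimedean local field (§2), `𝒪 = 𝒪[F]`, `𝓂 = maximalIdeal 𝒪`, `𝓀 = 𝓀[F]`;
`B = standardParabolicGL F id` (upper triangular), `T = standardLeviGL F id` (diagonal), `U = unipotentRadicalGL F id` (upper unitriangular),
`U⁻ = unipotentRadicalGL F (toDual ∘ id)` (lower unitriangular), `Iw = iwahoriGL n F` (★ `IwahoriGL`: `GL_n(𝒪)` upper triangular mod `𝓂`), `K_γ = congruenceGL n γ`.

THE MATHEMATICS [Casselman1995, Prop. 1.4.3–1.4.4]; [BruhatTits1972, (4.4.3)–(4.4.4)]; [IwahoriMatsumoto1965, §2]; [BernsteinZelevinsky1976, §3.13].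
* §1 **THE IWAHORI FACTORISATION OF `Iw` ITSELF** (`coe_iwahoriGL_eq_mul`): for `g ∈ Iw`, lift `red g ∈ B(𝓀)` to `b₀ ∈ B ∩ GL_n(𝒪)` (★ IH-1 §1), so `x := g b₀⁻¹ ∈ ker red`; over `𝒪`
  the congruence kernel of `𝓂` factors `x = n̄ · p` with `n̄` LOWER UNITRIANGULAR and `p` UPPER triangular, both `≡ 1 (mod 𝓂)` (★ `CongruenceKernel.exists_unipotent_mul_lower`
  for the labelling `toDual ∘ id`); so `g = n̄ · b` with `b = p b₀ ∈ B ∩ GL_n(𝒪)`, and `b = t · u` along the Levi projection of `B` (`t` = the diagonal of `b`, in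
  `T ∩ GL_n(𝒪) ≤ Iw`; `u = t⁻¹ b ∈ U ∩ Iw`).  The same splitting gives `K_γ = (K_γ ∩ U⁻)(K_γ ∩ T)(K_γ ∩ U)` for `γ < 1` (`coe_congruenceGL_eq_mul`) from the ★ two-factor
  form `exists_parabolic_mul_lower_of_mem_congruenceGL`.
* §2 the ★ `ParabolicTriple.IwahoriDatum` of the Borel triple AT LEVEL `Iw` (`exists_iwahoriDatum_iwahoriLevel`): `K 0 = Iw`, `K (j+1) = K_{|ϖ|^{j+1}}` (`0 < |ϖ| < 1`), `N̄ = U⁻`,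
  ray `a = diag(ϖ^{-i})`; compact-open ∕ basis fields from ★ `isOpen_congruenceGL` ∕ `isCompact_congruenceGL` ∕ `bigCellDatumGL.exists_K_subset`; factorisations from §1;
  the contraction `a^{-g}(H ∩ U⁻)a^{g} ≤ K_δ` for ANY `H ≤ GL_n(𝒪)` (`exists_inv_pow_conj_inf_lower_le`) from ★ `exists_conj_lower_mem_congruenceGL` (`GL_n(𝒪) ≤ K_1`).
HONEST LABEL: HC_CM is proved only modulo the 7 printed citations (2 remaining named inputs: hLiu418 = stmt-HodgeConjecture-24832, h413 = stmt-HodgeConjecture-24833)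
until rung 0 closes; count-neutral helper (structure theory; no printed citation is discharged).

## Mathlib ∕ tree search
Tree ★: `iwahoriGL`∕`mem_iwahoriGL_iff`∕`iwahoriGL_le_glInt`∕`isOpen_iwahoriGL`∕`isCompact_iwahoriGL`∕`glIntEquiv`∕`glIntReduction` (IwahoriGL) · IH-1 `exists_borel_glInt_glIntReduction_eq`∕
`glIntReduction_mem_borel(_of_mem_iwahori)`∕`mem_iwahori_of_glIntReduction_mem_borel` · `CongruenceKernel.exists_unipotent_mul_lower`∕`congruenceKer` (CongruenceKernelIwahori) ·
`exists_parabolic_mul_lower_of_mem_congruenceGL`∕`exists_conj_lower_mem_congruenceGL`∕`map_mem_unipotentRadicalGL`∕`map_mem_standardParabolicGL`∕`bigCellDatumGL`∕`zpowDiagGL_mem_standardLeviGL`∕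
`blockDiagonalGL_leviZpowDiag` (ParabolicGLBigCell) · `leviZpowDiag_mem_center` · `zpowDiagGL_add`∕`_zero`∕`_neg` (IwasawaDecompositionGL) · `mem_congruenceGL_iff`∕`congruenceGL_le_glInt`∕
`isOpen_congruenceGL`∕`isCompact_congruenceGL`∕`ValBound.*` (GLnCongruenceSubgroups) · `blockDiagonalGL_apply_coe`, `leviProjection_leviEmbeddingP_apply` (ParabolicGL) · `ParabolicTriple.IwahoriDatum`.
Mathlib: `Matrix.blockDiagonal'_apply_eq`∕`_ne`, `Set.mem_mul`, `IsLocalRing.jacobson_eq_maximalIdeal`.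
Dedup: `rg "coe_iwahoriGL_eq_mul|iwahoriDatum_iwahoriLevel|coe_congruenceGL_eq_mul|inv_pow_conj"` over `Literature Summits` — the `U(3)` twins ★ `K2E3IwahoriFactorisationThree` ∕
★ `K2E3IwahoriLevelDatum` (unitary group in three variables; not `GL_n`); the `GL_n` principal-congruence-level datum ★ `iwahoriDatumGL` (unbuilt, see above; its `K 0` is
`K_{|ϖ|}`, not `Iw`).

## References
* [Casselman1995] W. Casselman, *Introduction to the theory of admissible representations of p-adic reductive groups* (1995 notes), Prop. 1.4.3–1.4.4, Thm. 3.3.3.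
* [BruhatTits1972] F. Bruhat, J. Tits, *Groupes réductifs sur un corps local I*, Publ. Math. IHÉS 41 (1972), (4.4.3)–(4.4.4).
* [IwahoriMatsumoto1965] N. Iwahori, H. Matsumoto, Publ. Math. IHÉS 25 (1965), §2.  * [Borel1976] A. Borel, Invent. Math. 35 (1976), §3–§4.
* [BernsteinZelevinsky1976] I. N. Bernstein, A. V. Zelevinsky, Russian Math. Surveys 31:3 (1976), §3.13.  * [BernsteinZelevinsky1977] Ann. Sci. ÉNS 10 (1977), §2.1.
-/

set_option autoImplicit false
-- the mandated namespace repeats the single-problem summit's segment (`HodgeConjecture.HodgeConjecture`)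
set_option linter.dupNamespace false

noncomputable section

open Matrix
open scoped MatrixGroups Pointwise
open Literature.NumberTheory.Automorphic ValuativeRel
open Summit.HodgeConjecture.HodgeConjecture.Cruxes.H413.K2E3GL3IwahoriBruhat

namespace Summit.HodgeConjecture.HodgeConjecture.Cruxes.H413.K2E3GLnIwahoriFactorisation

universe u

/-! ## §1 The Iwahori factorisations `Iw = (Iw ∩ U⁻)(Iw ∩ T)(Iw ∩ U)` and `K_γ = (K_γ ∩ U⁻)(K_γ ∩ T)(K_γ ∩ U)` -/

section Factorisation

variable {F : Type u} [Field F] [ValuativeRel F] {n : ℕ}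

/-- `GL_n(𝒪) ≤ K_1` (the principal congruence subgroup of level `γ = 1` is all of `GL_n(𝒪)`: integral entries, integral inverse). [cite: Casselman1995, Prop. 1.4.3] -/
theorem glInt_le_congruenceGL_one : glInt n F ≤ congruenceGL n 1 := by
  intro g hg
  obtain ⟨h1, h2⟩ := (mem_glInt_iff g).1 hg
  have hv : ValBound 1 (g : Matrix (Fin n) (Fin n) F) := fun i j => (Valuation.mem_integer_iff _ _).1 (h1 i j)
  have hv' : ValBound 1 ((g⁻¹ : GL (Fin n) F) : Matrix (Fin n) (Fin n) F) := fun i j => (Valuation.mem_integer_iff _ _).1 (h2 i j)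
  exact mem_congruenceGL_iff.2 ⟨⟨hv, hv'⟩, hv.sub valBound_one, hv'.sub valBound_one⟩

/-- **`K_γ ≤ Iw` for `γ < 1`**: a `γ`-congruent matrix is integral with sub-diagonal entries of valuation `≤ γ < 1`. [cite: Casselman1995, Prop. 1.4.4] [cite: BruhatTits1972, (4.4.3)] -/
theorem congruenceGL_le_iwahoriGL {γ : ValueGroupWithZero F} (hγ : γ < 1) : congruenceGL n γ ≤ iwahoriGL n F := by
  intro g hg
  refine (mem_iwahoriGL_iff g).2 ⟨congruenceGL_le_glInt γ hg, fun i j hij => ?_⟩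
  have h := (mem_congruenceGL_iff.1 hg).2.1 i j
  rw [Matrix.sub_apply, Matrix.one_apply_ne (ne_of_gt hij), sub_zero] at h
  exact h.trans_lt hγ

/-- **`B ∩ GL_n(𝒪) ≤ Iw`**: an integral upper triangular matrix with integral inverse reduces into `B(𝓀)` (★ IH-1 §1). [cite: IwahoriMatsumoto1965, §2] -/
theorem mem_iwahoriGL_of_mem_borel_of_mem_glInt {b : GL (Fin n) F} (hbB : b ∈ standardParabolicGL F (id : Fin n → Fin n)) (hb : b ∈ glInt n F) :
    b ∈ iwahoriGL n F :=
  mem_iwahori_of_glIntReduction_mem_borel hb (glIntReduction_mem_borel hb hbB)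

/-- **`Iw ⊆ (Iw ∩ U⁻) · (B ∩ GL_n(𝒪))`**: for `g ∈ Iw` lift `red g ∈ B(𝓀)` to `b₀ ∈ B ∩ GL_n(𝒪)` (★ IH-1 `exists_borel_glInt_glIntReduction_eq`), so that `x := g b₀⁻¹ ∈ GL_n(𝒪)`
reduces to `1`; over `𝒪` the congruence kernel of `𝓂` factors `x = n̄ p` with `n̄` lower unitriangular and `p` upper triangular, both `≡ 1 (mod 𝓂)` (★
`CongruenceKernel.exists_unipotent_mul_lower` for the labelling `toDual ∘ id`), and `g = n̄ · (p b₀)`. [cite: IwahoriMatsumoto1965, §2] [cite: BernsteinZelevinsky1976, §3.13]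
[cite: BruhatTits1972, (4.4.3)] -/
theorem exists_lower_mul_borel_of_mem_iwahoriGL {g : GL (Fin n) F} (hg : g ∈ iwahoriGL n F) :
    ∃ nb ∈ iwahoriGL n F ⊓ unipotentRadicalGL F (⇑OrderDual.toDual ∘ (id : Fin n → Fin n)),
      ∃ b ∈ standardParabolicGL F (id : Fin n → Fin n), b ∈ glInt n F ∧ g = nb * b := by
  have hgint : g ∈ glInt n F := iwahoriGL_le_glInt n F hg
  obtain ⟨b₀, hb₀, hb₀B, hred⟩ := exists_borel_glInt_glIntReduction_eq (glIntReduction n F ⟨g, hgint⟩)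
    (glIntReduction_mem_borel_of_mem_iwahori hg hgint)
  have hxint : g * b₀⁻¹ ∈ glInt n F := mul_mem hgint (inv_mem hb₀)
  have hxred : glIntReduction n F ⟨g * b₀⁻¹, hxint⟩ = 1 := by
    have hsub : (⟨g * b₀⁻¹, hxint⟩ : glInt n F) = ⟨g, hgint⟩ * (⟨b₀, hb₀⟩ : glInt n F)⁻¹ := rfl
    rw [hsub, map_mul, map_inv, hred, mul_inv_cancel]
  -- over `𝒪`: `x = n̄ p` in the congruence kernel of `𝓂`
  set k : GL (Fin n) 𝒪[F] := (glIntEquiv n F).symm ⟨g * b₀⁻¹, hxint⟩ with hk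
  have hkK : k ∈ CongruenceKernel.congruenceKer (IsLocalRing.maximalIdeal 𝒪[F]) (Fin n) := by
    rw [CongruenceKernel.congruenceKer, MonoidHom.mem_ker]
    exact hxred
  have h𝔪 : IsLocalRing.maximalIdeal 𝒪[F] ≤ Ideal.jacobson ⊥ := (IsLocalRing.jacobson_eq_maximalIdeal ⊥ bot_ne_top).ge
  obtain ⟨u', hu'K, p', -, hu'U, hp'P, hkup⟩ :=
    CongruenceKernel.exists_unipotent_mul_lower h𝔪 (⇑OrderDual.toDual ∘ (id : Fin n → Fin n)) hkK
  -- back in `GL_n(F)`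
  have hmapk : Matrix.GeneralLinearGroup.map (𝒪[F]).subtype k = g * b₀⁻¹ := by
    have h := MulEquiv.apply_symm_apply (glIntEquiv n F) ⟨g * b₀⁻¹, hxint⟩
    rw [← hk] at h
    exact congrArg Subtype.val h
  have hnbU : Matrix.GeneralLinearGroup.map (𝒪[F]).subtype u' ∈ unipotentRadicalGL F (⇑OrderDual.toDual ∘ (id : Fin n → Fin n)) :=
    map_mem_unipotentRadicalGL _ _ hu'U
  have hnbint : Matrix.GeneralLinearGroup.map (𝒪[F]).subtype u' ∈ glInt n F := ⟨u', rfl⟩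
  have hnbred : glIntReduction n F ⟨Matrix.GeneralLinearGroup.map (𝒪[F]).subtype u', hnbint⟩ = 1 := by
    have h1 : (⟨Matrix.GeneralLinearGroup.map (𝒪[F]).subtype u', hnbint⟩ : glInt n F) = glIntEquiv n F u' := rfl
    rw [h1, glIntReduction, MonoidHom.comp_apply, MulEquiv.coe_toMonoidHom, MulEquiv.symm_apply_apply]
    exact (MonoidHom.mem_ker).1 hu'K
  have hnbIw : Matrix.GeneralLinearGroup.map (𝒪[F]).subtype u' ∈ iwahoriGL n F :=
    mem_iwahori_of_glIntReduction_mem_borel hnbint (by rw [hnbred]; exact one_mem _)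
  have hpB : Matrix.GeneralLinearGroup.map (𝒪[F]).subtype p' ∈ standardParabolicGL F (id : Fin n → Fin n) := by
    have h := map_mem_standardParabolicGL (𝒪[F]).subtype (⇑OrderDual.toDual ∘ ⇑OrderDual.toDual ∘ (id : Fin n → Fin n)) hp'P
    intro i j hij
    exact h hij
  have hpint : Matrix.GeneralLinearGroup.map (𝒪[F]).subtype p' ∈ glInt n F := ⟨p', rfl⟩
  refine ⟨_, ⟨hnbIw, hnbU⟩, Matrix.GeneralLinearGroup.map (𝒪[F]).subtype p' * b₀, mul_mem hpB hb₀B, mul_mem hpint hb₀, ?_⟩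
  rw [← mul_assoc, ← map_mul, ← hkup, hmapk, inv_mul_cancel_right]

variable {α : Type*} [LinearOrder α] [Fintype α]

/-- **The block-diagonal part of `p ∈ P_c ∩ K_γ` lies in `K_γ`** (`γ ≤ 1`, ANY block labelling `c`): its entries (and those of its inverse, the block-diagonal part of `p⁻¹`)
are entries of `p^{±1}` or `0`. [cite: Casselman1995, Prop. 1.4.4] [cite: BernsteinZelevinsky1977, §2.1] -/
theorem blockDiagonalGL_leviProjection_mem_congruenceGL' (c : Fin n → α) {γ : ValueGroupWithZero F} (hγ : γ ≤ 1)
    (p : standardParabolicGL F c) (hp : (p : GL (Fin n) F) ∈ congruenceGL n γ) :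
    blockDiagonalGL F c (leviProjection F c p) ∈ congruenceGL n γ := by
  -- entries of `diag(proj q)`
  have hentry : ∀ (q : standardParabolicGL F c) (i j : Fin n),
      ((blockDiagonalGL F c (leviProjection F c q) : GL (Fin n) F) : Matrix (Fin n) (Fin n) F) i j =
        if c i = c j then ((q : GL (Fin n) F) : Matrix (Fin n) (Fin n) F) i j else 0 := by
    intro q i j
    rw [blockDiagonalGL_apply_coe]
    split_ifs with h
    · have : (⟨c j, ⟨j, rfl⟩⟩ : Σ a, {l // c l = a}) = ⟨c i, ⟨j, h.symm⟩⟩ := Sigma.subtype_ext h.symm rfl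
      rw [this, Matrix.blockDiagonal'_apply_eq, leviProjection_apply_coe]
    · exact Matrix.blockDiagonal'_apply_ne _ _ _ h
  have hsub : ∀ q : standardParabolicGL F c, (q : GL (Fin n) F) ∈ congruenceGL n γ →
      ValBound γ (((blockDiagonalGL F c (leviProjection F c q) : GL (Fin n) F) : Matrix (Fin n) (Fin n) F) - 1) := by
    intro q hq i j
    rw [Matrix.sub_apply, hentry]
    split_ifs with h
    · have := hq.2.1 i j
      rwa [Matrix.sub_apply] at this
    · have hij : i ≠ j := fun hij => h (hij ▸ rfl)
      rw [Matrix.one_apply_ne hij, sub_zero, map_zero]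
      exact zero_le
  have h1 := hsub p hp
  have h2 := hsub p⁻¹ (Subgroup.inv_mem _ hp)
  rw [map_inv, map_inv] at h2
  exact ⟨⟨h1.of_sub_one hγ, h2.of_sub_one hγ⟩, h1, h2⟩

/-- The block-diagonal part of `p ∈ P_c ∩ GL_n(𝒪)` lies in `GL_n(𝒪)` (`GL_n(𝒪) = K_1`). [cite: Casselman1995, Prop. 1.4.4] -/
theorem blockDiagonalGL_leviProjection_mem_glInt (c : Fin n → α) (p : standardParabolicGL F c) (hp : (p : GL (Fin n) F) ∈ glInt n F) :
    blockDiagonalGL F c (leviProjection F c p) ∈ glInt n F :=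
  congruenceGL_le_glInt 1 (blockDiagonalGL_leviProjection_mem_congruenceGL' c le_rfl p (glInt_le_congruenceGL_one hp))

omit [ValuativeRel F] in
/-- **`diag(p)⁻¹ · p ∈ U_c`** for `p ∈ P_c` (`diag(p)` = the block-diagonal part ★ `blockDiagonalGL ∘ leviProjection`; the quotient is killed by the Levi projection).
[cite: BernsteinZelevinsky1977, §2.1] -/
theorem inv_levi_mul_mem_unipotentRadicalGL (c : Fin n → α) (p : standardParabolicGL F c) :
    (blockDiagonalGL F c (leviProjection F c p))⁻¹ * (p : GL (Fin n) F) ∈ unipotentRadicalGL F c := by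
  have h : (leviEmbeddingP F c (leviProjection F c p))⁻¹ * p ∈ unipotentRadicalP F c := by
    rw [MonoidHom.mem_ker, map_mul, map_inv, leviProjection_leviEmbeddingP_apply, inv_mul_cancel]
  exact ⟨_, h, rfl⟩

omit [ValuativeRel F] in
/-- A block diagonal matrix lies in the standard Levi (the range of ★ `leviEmbedding`). [cite: BernsteinZelevinsky1977, §2.1] -/
theorem blockDiagonalGL_mem_standardLeviGL (c : Fin n → α) (m : Π a, GL {i // c i = a} F) : blockDiagonalGL F c m ∈ standardLeviGL F c := ⟨m, rfl⟩

omit [ValuativeRel F] in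
/-- **THREE-FACTOR ASSEMBLY**: if `g = n̄ · b` with `n̄ ∈ H ∩ U⁻` and `b ∈ B ∩ H` for a subgroup `H ≤ GL_n(F)` such that the diagonal part of every element of `B ∩ H` lies in
`H`, then `g ∈ (H ∩ U⁻) · (H ∩ T) · (H ∩ U)` (`b = t · (t⁻¹ b)` along the Levi projection of `B`). [cite: Casselman1995, Prop. 1.4.4] [cite: BruhatTits1972, (4.4.3)] -/
theorem mem_mul_mul_of_eq_lower_mul_borel (H : Subgroup (GL (Fin n) F))
    (hH : ∀ p : standardParabolicGL F (id : Fin n → Fin n), (p : GL (Fin n) F) ∈ H → blockDiagonalGL F (id : Fin n → Fin n) (leviProjection F (id : Fin n → Fin n) p) ∈ H)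
    {g nb b : GL (Fin n) F} (hnb : nb ∈ H ⊓ unipotentRadicalGL F (⇑OrderDual.toDual ∘ (id : Fin n → Fin n)))
    (hbB : b ∈ standardParabolicGL F (id : Fin n → Fin n)) (hbH : b ∈ H) (hg : g = nb * b) :
    g ∈ ((H ⊓ unipotentRadicalGL F (⇑OrderDual.toDual ∘ (id : Fin n → Fin n)) : Subgroup (GL (Fin n) F)) : Set (GL (Fin n) F)) *
        ((H ⊓ standardLeviGL F (id : Fin n → Fin n) : Subgroup (GL (Fin n) F)) : Set (GL (Fin n) F)) *
        ((H ⊓ unipotentRadicalGL F (id : Fin n → Fin n) : Subgroup (GL (Fin n) F)) : Set (GL (Fin n) F)) := by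
  have htH := hH ⟨b, hbB⟩ hbH
  refine Set.mem_mul.2 ⟨nb * blockDiagonalGL F (id : Fin n → Fin n) (leviProjection F (id : Fin n → Fin n) ⟨b, hbB⟩),
    Set.mem_mul.2 ⟨nb, hnb, _, Subgroup.mem_inf.2 ⟨htH, blockDiagonalGL_mem_standardLeviGL _ _⟩, rfl⟩,
    (blockDiagonalGL F (id : Fin n → Fin n) (leviProjection F (id : Fin n → Fin n) ⟨b, hbB⟩))⁻¹ * b,
    Subgroup.mem_inf.2 ⟨H.mul_mem (H.inv_mem htH) hbH, inv_levi_mul_mem_unipotentRadicalGL _ ⟨b, hbB⟩⟩, ?_⟩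
  rw [hg, mul_assoc, mul_inv_cancel_left]

/-- **THE IWAHORI FACTORISATION OF THE IWAHORI SUBGROUP OF `GL_n(F)`**: as sets, `Iw = (Iw ∩ U⁻) · (Iw ∩ T) · (Iw ∩ U)` — the `factorization` field of a ★
`ParabolicTriple.IwahoriDatum` at level `Iw` (no uniqueness recorded): `exists_lower_mul_borel_of_mem_iwahoriGL` and the three-factor assembly for `H = Iw` (the diagonal part of
`b ∈ B ∩ Iw ≤ GL_n(𝒪)` is in `T ∩ GL_n(𝒪) ≤ Iw`). [cite: Casselman1995, Prop. 1.4.4] [cite: BruhatTits1972, (4.4.3)–(4.4.4)] [cite: IwahoriMatsumoto1965, §2] -/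
theorem coe_iwahoriGL_eq_mul :
    (iwahoriGL n F : Set (GL (Fin n) F)) =
      ((iwahoriGL n F ⊓ unipotentRadicalGL F (⇑OrderDual.toDual ∘ (id : Fin n → Fin n)) : Subgroup (GL (Fin n) F)) : Set (GL (Fin n) F)) *
        ((iwahoriGL n F ⊓ standardLeviGL F (id : Fin n → Fin n) : Subgroup (GL (Fin n) F)) : Set (GL (Fin n) F)) *
        ((iwahoriGL n F ⊓ unipotentRadicalGL F (id : Fin n → Fin n) : Subgroup (GL (Fin n) F)) : Set (GL (Fin n) F)) := by
  apply le_antisymm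
  · intro g hg
    obtain ⟨nb, hnb, b, hbB, hb, hgeq⟩ := exists_lower_mul_borel_of_mem_iwahoriGL (show g ∈ iwahoriGL n F from hg)
    refine mem_mul_mul_of_eq_lower_mul_borel (iwahoriGL n F) (fun p hp => ?_) hnb hbB (mem_iwahoriGL_of_mem_borel_of_mem_glInt hbB hb) hgeq
    have hpint := blockDiagonalGL_leviProjection_mem_glInt (id : Fin n → Fin n) p (iwahoriGL_le_glInt n F hp)
    exact mem_iwahoriGL_of_mem_borel_of_mem_glInt (standardLeviGL_le F _ (blockDiagonalGL_mem_standardLeviGL _ _)) hpint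
  · rintro _ ⟨_, ⟨a, ha, m, hm, rfl⟩, u, hu, rfl⟩
    exact mul_mem (mul_mem ha.1 hm.1) hu.1

/-- **THE IWAHORI FACTORISATION OF THE PRINCIPAL CONGRUENCE SUBGROUPS W.R.T. THE BOREL**: `K_γ = (K_γ ∩ U⁻) · (K_γ ∩ T) · (K_γ ∩ U)` for `γ < 1` — the ★ two-factor form
`exists_parabolic_mul_lower_of_mem_congruenceGL` (applied to `k⁻¹`) and the three-factor assembly for `H = K_γ` (`blockDiagonalGL_leviProjection_mem_congruenceGL'`).
[cite: Casselman1995, Prop. 1.4.4] [cite: BernsteinZelevinsky1976, §3.13] -/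
theorem coe_congruenceGL_eq_mul {γ : ValueGroupWithZero F} (hγ : γ < 1) :
    (congruenceGL n γ : Set (GL (Fin n) F)) =
      ((congruenceGL n γ ⊓ unipotentRadicalGL F (⇑OrderDual.toDual ∘ (id : Fin n → Fin n)) : Subgroup (GL (Fin n) F)) : Set (GL (Fin n) F)) *
        ((congruenceGL n γ ⊓ standardLeviGL F (id : Fin n → Fin n) : Subgroup (GL (Fin n) F)) : Set (GL (Fin n) F)) *
        ((congruenceGL n γ ⊓ unipotentRadicalGL F (id : Fin n → Fin n) : Subgroup (GL (Fin n) F)) : Set (GL (Fin n) F)) := by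
  apply le_antisymm
  · intro k hk
    have hk : k ∈ congruenceGL n γ := hk
    obtain ⟨p, hpB, hpK, u, huU, huK, hkinv⟩ := exists_parabolic_mul_lower_of_mem_congruenceGL (id : Fin n → Fin n) hγ (inv_mem hk)
    have hkeq : k = u⁻¹ * p⁻¹ := by rw [← _root_.mul_inv_rev, ← hkinv, inv_inv]
    exact mem_mul_mul_of_eq_lower_mul_borel (congruenceGL n γ) (fun q hq => blockDiagonalGL_leviProjection_mem_congruenceGL' _ hγ.le q hq)
      (Subgroup.mem_inf.2 ⟨(congruenceGL n γ).inv_mem huK, (unipotentRadicalGL F _).inv_mem huU⟩)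
      ((standardParabolicGL F _).inv_mem hpB) ((congruenceGL n γ).inv_mem hpK) hkeq
  · rintro _ ⟨_, ⟨a, ha, m, hm, rfl⟩, u, hu, rfl⟩
    exact mul_mem (mul_mem ha.1 hm.1) hu.1

end Factorisation

/-! ## §2 The Iwahori datum of the Borel of `GL_n(F)` at level `Iw` -/

section Datum

variable {F : Type u} [Field F] [ValuativeRel F] [TopologicalSpace F] [IsNonarchimedeanLocalField F] {n : ℕ}

/-- **Contraction of `H ∩ U⁻` by the ray `a = diag(ϖ^{-i})`**, for any `H ≤ GL_n(𝒪)` (`H = Iw` or `K_γ`): for every `0 ≠ δ ≤ 1` some `a^{-g}(H ∩ U⁻)a^{g}` lies in `K_δ` —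
★ `exists_conj_lower_mem_congruenceGL` on `H ∩ U⁻ ≤ U⁻ ∩ K_1`, with `(a^g)⁻¹ = diag(ϖ^{g i})`. [cite: Casselman1995, Prop. 1.4.3] [cite: BruhatTits1972, (4.4.4)] -/
theorem exists_inv_pow_conj_inf_lower_le {ϖ : F} (hϖ0 : valuation F ϖ ≠ 0) (hϖ1 : valuation F ϖ < 1) {H : Subgroup (GL (Fin n) F)} (hHint : H ≤ glInt n F)
    {δ : ValueGroupWithZero F} (hδ : δ ≠ 0) (hδ1 : δ ≤ 1) :
    ∃ g : ℕ, ConjAct.toConjAct (zpowDiagGL ((Valuation.ne_zero_iff _).1 hϖ0) (fun i : Fin n => -((i : ℕ) : ℤ)) ^ g)⁻¹ •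
        (H ⊓ unipotentRadicalGL F (⇑OrderDual.toDual ∘ (id : Fin n → Fin n))) ≤ congruenceGL n δ := by
  obtain ⟨g, hg⟩ := exists_conj_lower_mem_congruenceGL (id : Fin n → Fin n) ((Valuation.ne_zero_iff _).1 hϖ0) hϖ0 hϖ1 1 1 hδ hδ1
  refine ⟨g, ?_⟩
  -- `(a^g)⁻¹ = diag(ϖ^{g i})`
  have hpow : ∀ m : ℕ, zpowDiagGL ((Valuation.ne_zero_iff _).1 hϖ0) (fun i : Fin n => -((i : ℕ) : ℤ)) ^ m =
      zpowDiagGL ((Valuation.ne_zero_iff _).1 hϖ0) (fun i : Fin n => -((m : ℤ) * ((i : ℕ) : ℤ))) := by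
    intro m
    induction m with
    | zero =>
      rw [pow_zero]
      have : (fun i : Fin n => -(((0 : ℕ) : ℤ) * ((i : ℕ) : ℤ))) = 0 := funext fun i => by simp
      rw [this, zpowDiagGL_zero]
    | succ m ih =>
      rw [pow_succ, ih, ← zpowDiagGL_add]
      congr 1
      funext i
      simp only [Pi.add_apply, Nat.cast_succ]
      ring
  have ha : (zpowDiagGL ((Valuation.ne_zero_iff _).1 hϖ0) (fun i : Fin n => -((i : ℕ) : ℤ)) ^ g)⁻¹ =
      zpowDiagGL ((Valuation.ne_zero_iff _).1 hϖ0) (fun i => (g : ℤ) * ((id : Fin n → Fin n) i : ℕ)) := by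
    rw [hpow, ← zpowDiagGL_neg]
    congr 1
    funext i
    simp only [Pi.neg_apply, neg_neg, id]
  rintro _ ⟨u, ⟨huH, huU⟩, rfl⟩
  rw [MulDistribMulAction.toMonoidEnd_apply, MulDistribMulAction.toMonoidHom_apply, ConjAct.smul_def, ConjAct.ofConjAct_toConjAct, ha]
  have := hg u huU (glInt_le_congruenceGL_one (hHint huH))
  rwa [one_mul] at this

omit [ValuativeRel F] [TopologicalSpace F] [IsNonarchimedeanLocalField F] in
/-- The ray `diag(ϖ^{e})` commutes with the diagonal torus `T` (indeed with any standard Levi containing it; ★ `leviZpowDiag_mem_center`). [cite: Casselman1995, Prop. 1.4.3] -/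
theorem mul_zpowDiagGL_comm_of_mem_standardLeviGL {ϖ : F} (hϖ : ϖ ≠ 0) (e : Fin n → ℤ) {m : GL (Fin n) F}
    (hm : m ∈ standardLeviGL F (id : Fin n → Fin n)) : m * zpowDiagGL hϖ e = zpowDiagGL hϖ e * m := by
  obtain ⟨l, rfl⟩ := hm
  rw [leviEmbedding_apply, ← blockDiagonalGL_leviZpowDiag (id : Fin n → Fin n) hϖ, ← map_mul, ← map_mul,
    (Subgroup.mem_center_iff.1 (leviZpowDiag_mem_center (id : Fin n → Fin n) hϖ (e := e) (fun i j h => congrArg e (h : i = j))) l)]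

/-- **THE IWAHORI DATUM OF THE BOREL `B ≤ GL_n(F)` AT LEVEL `Iw`**: levels `K 0 = Iw`, `K (j+1) = K_{|ϖ|^{j+1}}` (`0 < |ϖ| < 1`, not necessarily a uniformiser); opposite radical
`N̄ = U⁻`; ray `a = diag(ϖ^{-i}) ∈ T`.  `Iw` and the `K_γ` are compact open ★ and the `K_γ` form a neighbourhood basis (★ `bigCellDatumGL.exists_K_subset`); the factorisation
fields are §1 `coe_iwahoriGL_eq_mul` ∕ `coe_congruenceGL_eq_mul`; the contraction field is `exists_inv_pow_conj_inf_lower_le` (into `K_{|ϖ|^{j+1}}`, and `K_{|ϖ|} ≤ Iw`).  The input of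
★ Jacquet's lemma `JacquetLemma.fixedPoints_jacquetModule_le_map` AT THE IWAHORI LEVEL. [cite: Casselman1995, Prop. 1.4.4, Thm. 3.3.3] [cite: BruhatTits1972, (4.4.3)–(4.4.4)]
[cite: Borel1976, §3–§4] -/
theorem exists_iwahoriDatum_iwahoriLevel {ϖ : F} (hϖ0 : valuation F ϖ ≠ 0) (hϖ1 : valuation F ϖ < 1) :
    ∃ 𝓘 : (parabolicTripleGL F (id : Fin n → Fin n)).IwahoriDatum,
      𝓘.K 0 = iwahoriGL n F ∧ (∀ j : ℕ, 𝓘.K (j + 1) = congruenceGL n (valuation F ϖ ^ (j + 1))) ∧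
      𝓘.Nbar = unipotentRadicalGL F (⇑OrderDual.toDual ∘ (id : Fin n → Fin n)) ∧
      𝓘.a = zpowDiagGL ((Valuation.ne_zero_iff _).1 hϖ0) (fun i : Fin n => -((i : ℕ) : ℤ)) := by
  have hγlt : ∀ j : ℕ, valuation F ϖ ^ (j + 1) < 1 := fun j => pow_lt_one₀ zero_le hϖ1 (Nat.succ_ne_zero j)
  have hK1 : congruenceGL n (valuation F ϖ ^ (0 + 1)) ≤ iwahoriGL n F := congruenceGL_le_iwahoriGL (hγlt 0)
  refine ⟨{ Nbar := unipotentRadicalGL F (⇑OrderDual.toDual ∘ (id : Fin n → Fin n))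
            a := zpowDiagGL ((Valuation.ne_zero_iff _).1 hϖ0) (fun i : Fin n => -((i : ℕ) : ℤ))
            a_mem := zpowDiagGL_mem_standardLeviGL (id : Fin n → Fin n) _ _
            a_comm := fun m hm => mul_zpowDiagGL_comm_of_mem_standardLeviGL _ _ hm
            K := fun j => match j with
              | 0 => iwahoriGL n F
              | (j + 1) => congruenceGL n (valuation F ϖ ^ (j + 1))
            isOpen_K := fun j => match j with
              | 0 => isOpen_iwahoriGL n F
              | (j + 1) => isOpen_congruenceGL (pow_ne_zero _ hϖ0)
            isCompact_K := fun j => match j with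
              | 0 => isCompact_iwahoriGL n F
              | (j + 1) => isCompact_congruenceGL _
            hasBasis_K := fun O hO => by
              obtain ⟨j, hj⟩ := (bigCellDatumGL (c := (id : Fin n → Fin n)) monotone_id hϖ0 hϖ1).exists_K_subset O hO
              exact ⟨j + 1, hj⟩
            factorization := fun j => match j with
              | 0 => coe_iwahoriGL_eq_mul
              | (j + 1) => coe_congruenceGL_eq_mul (hγlt j)
            exists_conj_inf_Nbar_le := ?_ }, rfl, fun j => rfl, rfl, rfl⟩
  intro m j
  match m, j with
  | 0, 0 =>
      obtain ⟨i, hi⟩ := exists_inv_pow_conj_inf_lower_le hϖ0 hϖ1 (iwahoriGL_le_glInt n F) (δ := valuation F ϖ ^ (0 + 1))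
        (pow_ne_zero _ hϖ0) (pow_le_one₀ zero_le hϖ1.le)
      exact ⟨i, hi.trans hK1⟩
  | 0, (j + 1) =>
      exact exists_inv_pow_conj_inf_lower_le hϖ0 hϖ1 (iwahoriGL_le_glInt n F) (δ := valuation F ϖ ^ (j + 1))
        (pow_ne_zero _ hϖ0) (pow_le_one₀ zero_le hϖ1.le)
  | (m + 1), 0 =>
      obtain ⟨i, hi⟩ := exists_inv_pow_conj_inf_lower_le hϖ0 hϖ1 (congruenceGL_le_glInt (valuation F ϖ ^ (m + 1))) (δ := valuation F ϖ ^ (0 + 1))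
        (pow_ne_zero _ hϖ0) (pow_le_one₀ zero_le hϖ1.le)
      exact ⟨i, hi.trans hK1⟩
  | (m + 1), (j + 1) =>
      exact exists_inv_pow_conj_inf_lower_le hϖ0 hϖ1 (congruenceGL_le_glInt (valuation F ϖ ^ (m + 1))) (δ := valuation F ϖ ^ (j + 1))
        (pow_ne_zero _ hϖ0) (pow_le_one₀ zero_le hϖ1.le)

end Datum

end Summit.HodgeConjecture.HodgeConjecture.Cruxes.H413.K2E3GLnIwahoriFactorisation

end
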